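import Summits.CriticalPhenomena.PercolationContinuityZ3.Theorems.PercNearOneGluingNoHeavyLowerTailSahiCombTriWTranslate
import Summits.CriticalPhenomena.PercolationContinuityZ3.Theorems.PercNearOneGluingNoHeavyLowerTailSahiCombFiveUpSetProduct

/-!
# The two-block translate inequality on ONE cube implies `TriWGenIneq` (product-cube plumbing)

Support file of the one-cut programme (crux `NoHeavyLowerTail`, stmt-CriticalPhenomena-4575; cell `prim-masterthm`, seat P5 gen 18;
memo `FROM-prim-masterthm-p5-g18-SYMMETRIC-MASTER-FORM.md` §1, §9).

`DipoleIneq` is the single-cube, test-set ("dipole") form of the two-block case of the symmetric translate conjecture (memo §2(iii), §3):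
for up-sets `X, Y, h` of a cube `Finset α` and a translate `t`,
  `#(refl X ∩ Y ∩ h) + #(X ∩ refl Y ∩ h) + #(refl (X ∩ Y) ∩ h) ≤ 2·#(X ∩ Y ∩ h) + #(refl X ∩ transl t Y ∩ h)`.
It is exactly the conclusion of `dipoleIneq_of_certGenKernel` (file `…TriWCertGen`, the q-zeta certificate).  Here we prove
**`DipoleIneq → TriWGenIneq`** (hence `→ TriWIneq` by `triWIneq_of_triWGenIneq`): a monotone family `U : Finset β → Finset (Finset γ)`
of up-sets is the up-set `prodSet U = {u | u.toRight ∈ U u.toLeft}` of the product cube `Finset (β ⊕ γ)`; with `X = prodSet F`,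
`Y = prodSet G`, `h = prodSet U` and `t = 1_β` (all `β`-coordinates) the five counts of `DipoleIneq` are the five summand totals of
`triWGen U F G` (the third one after the re-indexing `x ↦ xᶜ`).
* `FiveUpSet.prodSet`, `mem_prodSet`, `isUpperSet_prodSet`, `card_filter_prod_eq_sum` (with `LatticeFiveUpSet.toLeft_compl/toRight_compl` of `…FiveUpSetProduct`);
* `FiveUpSet.DipoleIneq` (a `def … : Prop`, NOT asserted), **`FiveUpSet.triWGenIneq_of_dipoleIneq`**, `FiveUpSet.triWIneq_of_dipoleIneq`.
HONEST LABEL: reductions only; `DipoleIneq` is open (census: memo §3). [this work]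
-/

namespace Summit.CriticalPhenomena.PercolationContinuityZ3.Theorems

namespace FiveUpSet

open Finset
open scoped symmDiff

/-- **The two-block translate inequality, single-cube dipole form** (memo §2(iii)/§9; = (SYM) at the 2-block configurations; OPEN, census-clean
through `Z₂^5` exhaustively): for up-sets `X, Y, h` and any `t`,
`#(refl X ∩ Y ∩ h) + #(X ∩ refl Y ∩ h) + #(refl (X ∩ Y) ∩ h) ≤ 2·#(X ∩ Y ∩ h) + #(refl X ∩ transl t Y ∩ h)`.  A definition, not an assertion. [this work] -/
def DipoleIneq : Prop :=
  ∀ (α : Type) [DecidableEq α] [Fintype α] (X Y h : Finset (Finset α)) (t : Finset α),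
    IsUpperSet (X : Set (Finset α)) → IsUpperSet (Y : Set (Finset α)) → IsUpperSet (h : Set (Finset α)) →
    (refl X ∩ Y ∩ h).card + (X ∩ refl Y ∩ h).card + (refl (X ∩ Y) ∩ h).card
      ≤ 2 * (X ∩ Y ∩ h).card + (refl X ∩ transl t Y ∩ h).card

variable {β γ : Type} [DecidableEq β] [Fintype β] [DecidableEq γ] [Fintype γ]

/-- The product-cube up-set of a family: `prodSet U = {u : Finset (β ⊕ γ) | u.toRight ∈ U u.toLeft}`. [this work] -/
def prodSet (U : Finset β → Finset (Finset γ)) : Finset (Finset (β ⊕ γ)) :=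
  univ.filter (fun u => u.toRight ∈ U u.toLeft)

omit [DecidableEq β] in
/-- Membership in `prodSet`. [this work] -/
@[simp] theorem mem_prodSet {U : Finset β → Finset (Finset γ)} {u : Finset (β ⊕ γ)} :
    u ∈ prodSet U ↔ u.toRight ∈ U u.toLeft := by
  classical
  unfold prodSet; simp

omit [Fintype β] [Fintype γ] in
/-- `toLeft` commutes with symmetric difference. [folklore] -/
theorem toLeft_symmDiff' (u v : Finset (β ⊕ γ)) : (u ∆ v).toLeft = u.toLeft ∆ v.toLeft := by
  ext x; simp [Finset.mem_toLeft, Finset.mem_symmDiff]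

omit [Fintype β] [Fintype γ] in
/-- `toRight` commutes with symmetric difference. [folklore] -/
theorem toRight_symmDiff' (u v : Finset (β ⊕ γ)) : (u ∆ v).toRight = u.toRight ∆ v.toRight := by
  ext x; simp [Finset.mem_toRight, Finset.mem_symmDiff]

omit [DecidableEq β] in
/-- The product-cube up-set of a monotone family of up-sets is an up-set. [this work] -/
theorem isUpperSet_prodSet {U : Finset β → Finset (Finset γ)} (hU : ∀ x, IsUpperSet (U x : Set (Finset γ))) (hUm : Monotone U) :
    IsUpperSet (prodSet U : Set (Finset (β ⊕ γ))) := by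
  intro u v huv hu
  rw [Finset.mem_coe, mem_prodSet] at hu ⊢
  exact hU _ (Finset.toRight_subset_toRight huv) (hUm (Finset.toLeft_subset_toLeft huv) hu)

omit [DecidableEq β] [DecidableEq γ] in
/-- Fibre counting on the product cube: `#{u | R u.toLeft u.toRight} = Σ_x #{w | R x w}`. [folklore] -/
theorem card_filter_prod_eq_sum (R : Finset β → Finset γ → Prop) [∀ x w, Decidable (R x w)] :
    ((univ.filter (fun u : Finset (β ⊕ γ) => R u.toLeft u.toRight)).card : ℤ)
      = ∑ x : Finset β, ((univ.filter (fun w => R x w)).card : ℤ) := by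
  classical
  -- the bijection `Finset (β ⊕ γ) ≃ Finset β × Finset γ`
  let e : Finset (β ⊕ γ) ≃ Finset β × Finset γ :=
    ⟨fun u => (u.toLeft, u.toRight), fun p => p.1.disjSum p.2, fun u => Finset.toLeft_disjSum_toRight,
      fun p => by simp⟩
  have h1 : ((univ.filter (fun u : Finset (β ⊕ γ) => R u.toLeft u.toRight)).card : ℤ)
      = ∑ u : Finset (β ⊕ γ), (if R u.toLeft u.toRight then (1 : ℤ) else 0) := by
    rw [Finset.sum_boole]
  have h2 : ∀ x : Finset β, ((univ.filter (fun w => R x w)).card : ℤ) = ∑ w : Finset γ, (if R x w then (1 : ℤ) else 0) := by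
    intro x; rw [Finset.sum_boole]
  rw [h1]
  simp only [h2]
  rw [← Fintype.sum_prod_type' (fun x w => if R x w then (1 : ℤ) else 0)]
  exact Fintype.sum_equiv e _ _ (fun u => rfl)

/-- The all-`β` translate of the product cube. [this work] -/
def betaFlip (β γ : Type) [Fintype β] : Finset (β ⊕ γ) := (univ : Finset β).disjSum (∅ : Finset γ)

/-- **`DipoleIneq → TriWGenIneq`** (product-cube plumbing; memo §9).  With `X = prodSet F`, `Y = prodSet G`, `h = prodSet U`, `t = 1_β`:
`#(X∩Y∩h) = Σ_x #(U x ∩ F x ∩ G x)`, `#(X ∩ refl Y ∩ h) = Σ_x #(U x ∩ F x ∩ refl (G xᶜ))`, `#(refl X ∩ Y ∩ h) = Σ_x #(U x ∩ refl (F xᶜ) ∩ G x)`,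
`#(refl X ∩ transl t Y ∩ h) = Σ_x #(U x ∩ refl (F xᶜ) ∩ G xᶜ)`, and `#(refl (X ∩ Y) ∩ h) = Σ_x #(refl (U xᶜ) ∩ F x ∩ G x)` (re-index `x ↦ xᶜ`
and reflect). [this work] -/
theorem triWGenIneq_of_dipoleIneq (hD : DipoleIneq) : TriWGenIneq := by
  intro β γ _ _ _ _ U F G hU hF hG hUm hFm hGm
  have h := hD (β ⊕ γ) (prodSet F) (prodSet G) (prodSet U) (betaFlip β γ)
    (isUpperSet_prodSet hF hFm) (isUpperSet_prodSet hG hGm) (isUpperSet_prodSet hU hUm)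
  -- translate-membership on the product cube
  have memT : ∀ u : Finset (β ⊕ γ), u ∈ transl (betaFlip β γ) (prodSet G) ↔ u.toRight ∈ G u.toLeftᶜ := by
    intro u
    rw [mem_transl, mem_prodSet, toRight_symmDiff', toLeft_symmDiff', betaFlip, Finset.toLeft_disjSum, Finset.toRight_disjSum,
      symmDiff_univ_eq_compl, symmDiff_empty_right]
  have memR : ∀ (V : Finset β → Finset (Finset γ)) (u : Finset (β ⊕ γ)), u ∈ refl (prodSet V) ↔ u.toRightᶜ ∈ V u.toLeftᶜ := by
    intro V u; rw [mem_refl, mem_prodSet, LatticeFiveUpSet.toRight_compl, LatticeFiveUpSet.toLeft_compl]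
  -- the five counts
  have c1 : ((prodSet F ∩ prodSet G ∩ prodSet U).card : ℤ) = ∑ x : Finset β, ((U x ∩ F x ∩ G x).card : ℤ) := by
    have e1 : prodSet F ∩ prodSet G ∩ prodSet U
        = univ.filter (fun u : Finset (β ⊕ γ) => u.toRight ∈ U u.toLeft ∧ u.toRight ∈ F u.toLeft ∧ u.toRight ∈ G u.toLeft) := by
      ext u; simp only [mem_inter, mem_prodSet, mem_filter, mem_univ, true_and]; tauto
    rw [e1, card_filter_prod_eq_sum (fun x w => w ∈ U x ∧ w ∈ F x ∧ w ∈ G x)]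
    refine sum_congr rfl fun x _ => ?_
    congr 2; ext w; simp
  have c2 : ((prodSet F ∩ refl (prodSet G) ∩ prodSet U).card : ℤ) = ∑ x : Finset β, ((U x ∩ F x ∩ refl (G xᶜ)).card : ℤ) := by
    have e1 : prodSet F ∩ refl (prodSet G) ∩ prodSet U
        = univ.filter (fun u : Finset (β ⊕ γ) => u.toRight ∈ U u.toLeft ∧ u.toRight ∈ F u.toLeft ∧ u.toRightᶜ ∈ G u.toLeftᶜ) := by
      ext u; simp only [mem_inter, mem_prodSet, memR, mem_filter, mem_univ, true_and]; tauto
    rw [e1, card_filter_prod_eq_sum (fun x w => w ∈ U x ∧ w ∈ F x ∧ wᶜ ∈ G xᶜ)]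
    refine sum_congr rfl fun x _ => ?_
    congr 2; ext w; simp [mem_refl]
  have c4 : ((refl (prodSet F) ∩ prodSet G ∩ prodSet U).card : ℤ) = ∑ x : Finset β, ((U x ∩ refl (F xᶜ) ∩ G x).card : ℤ) := by
    have e1 : refl (prodSet F) ∩ prodSet G ∩ prodSet U
        = univ.filter (fun u : Finset (β ⊕ γ) => u.toRight ∈ U u.toLeft ∧ u.toRightᶜ ∈ F u.toLeftᶜ ∧ u.toRight ∈ G u.toLeft) := by
      ext u; simp only [mem_inter, mem_prodSet, memR, mem_filter, mem_univ, true_and]; tauto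
    rw [e1, card_filter_prod_eq_sum (fun x w => w ∈ U x ∧ wᶜ ∈ F xᶜ ∧ w ∈ G x)]
    refine sum_congr rfl fun x _ => ?_
    congr 2; ext w; simp [mem_refl]
  have c5 : ((refl (prodSet F) ∩ transl (betaFlip β γ) (prodSet G) ∩ prodSet U).card : ℤ)
      = ∑ x : Finset β, ((U x ∩ refl (F xᶜ) ∩ G xᶜ).card : ℤ) := by
    have e1 : refl (prodSet F) ∩ transl (betaFlip β γ) (prodSet G) ∩ prodSet U
        = univ.filter (fun u : Finset (β ⊕ γ) => u.toRight ∈ U u.toLeft ∧ u.toRightᶜ ∈ F u.toLeftᶜ ∧ u.toRight ∈ G u.toLeftᶜ) := by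
      ext u; simp only [mem_inter, memR, memT, mem_prodSet, mem_filter, mem_univ, true_and]; tauto
    rw [e1, card_filter_prod_eq_sum (fun x w => w ∈ U x ∧ wᶜ ∈ F xᶜ ∧ w ∈ G xᶜ)]
    refine sum_congr rfl fun x _ => ?_
    congr 2; ext w; simp [mem_refl]
  have c3 : ((refl (prodSet F ∩ prodSet G) ∩ prodSet U).card : ℤ) = ∑ x : Finset β, ((refl (U xᶜ) ∩ F x ∩ G x).card : ℤ) := by
    have e1 : refl (prodSet F ∩ prodSet G) ∩ prodSet U
        = univ.filter (fun u : Finset (β ⊕ γ) => u.toRight ∈ U u.toLeft ∧ u.toRightᶜ ∈ F u.toLeftᶜ ∧ u.toRightᶜ ∈ G u.toLeftᶜ) := by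
      ext u; simp only [mem_inter, refl_inter, memR, mem_prodSet, mem_filter, mem_univ, true_and]; tauto
    rw [e1, card_filter_prod_eq_sum (fun x w => w ∈ U x ∧ wᶜ ∈ F xᶜ ∧ wᶜ ∈ G xᶜ)]
    -- `#{w | w ∈ U x, wᶜ ∈ F xᶜ, wᶜ ∈ G xᶜ} = #(refl (U x) ∩ F xᶜ ∩ G xᶜ)` … then re-index `x ↦ xᶜ`
    have e2 : ∀ x : Finset β, ((univ.filter (fun w : Finset γ => w ∈ U x ∧ wᶜ ∈ F xᶜ ∧ wᶜ ∈ G xᶜ)).card : ℤ)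
        = ((refl (U xᶜᶜ) ∩ F xᶜ ∩ G xᶜ).card : ℤ) := by
      intro x
      rw [← card_refl (refl (U xᶜᶜ) ∩ F xᶜ ∩ G xᶜ)]
      congr 2; ext w
      simp [mem_refl, compl_compl]
    simp only [e2]
    exact Fintype.sum_equiv (complEquiv β) _ _ (fun x => by simp [complEquiv])
  -- assemble
  have hZ : ((refl (prodSet F) ∩ prodSet G ∩ prodSet U).card : ℤ) + (prodSet F ∩ refl (prodSet G) ∩ prodSet U).card
      + (refl (prodSet F ∩ prodSet G) ∩ prodSet U).card
      ≤ 2 * ((prodSet F ∩ prodSet G ∩ prodSet U).card : ℤ) + (refl (prodSet F) ∩ transl (betaFlip β γ) (prodSet G) ∩ prodSet U).card := by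
    exact_mod_cast h
  rw [c1, c2, c3, c4, c5] at hZ
  unfold triWGen triWGenTerm
  simp only [sum_add_distrib, sum_sub_distrib, ← mul_sum]
  linarith

/-- **`DipoleIneq → TriWIneq`**. [this work] -/
theorem triWIneq_of_dipoleIneq (hD : DipoleIneq) : TriWIneq :=
  triWIneq_of_triWGenIneq (triWGenIneq_of_dipoleIneq hD)

end FiveUpSet

end Summit.CriticalPhenomena.PercolationContinuityZ3.Theorems
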